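import Summits.CriticalPhenomena.PercolationContinuityZ3.Theorems.Transplant.SkelNeg1RootGlueTA
import Summits.CriticalPhenomena.PercolationContinuityZ3.Theorems.Transplant.SkelNeg1RootHoldsXEA
import Summits.CriticalPhenomena.PercolationContinuityZ3.Theorems.Transplant.SkelNeg1RootHoldsYA
import HarnessLib

/-!
# N1 (the `{±1}` node), (R) column under (ζ′) + the L closure: **THE LAW-CARRYING, LENGTH-BUDGETED ROOT OBLIGATION OF THE (ζ′) CHOICE FUNCTION** —
# `rootHoldsNOWFnL_negChoiceAllOTA (c Px mx) : RootHoldsNOWFnL NegB.LfA (negChoiceAllOTA (KS.gT 0 (KS.gxA c)) (KS.fT 0 KS.fxA) (KS.PR 0 Px) (SUA exA mx))`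
# (A-twin of `SkelNeg1RootHolds`, p3-g10; slot ledger (ζ′) v1, stmt-g16 2026-08-22T04:40:26Z: `gx := KS.gxA c` (c a binder), `fx := KS.fxA`, `ex := exA`,
# `Px`/`mx` GENERAL): the x-family (`NegB.rootOblTWAt_negBTA_x_exA`, SkelNeg1RootHoldsXEA) and the y′-family (`NegB.rootOblTWAt_negBTA_y_exA`,
# SkelNeg1RootHoldsYA) glued by `rootHoldsNOWFnL_negChoiceAllOTA_of_xy` (SkelNeg1RootGlueTA), the flat root table `FlatL NegB.LfA κ` threaded through,
# the two `×Kq` floors `2000·Kq·(RA′+2) ≤ 2400·Kq·(RA′+2) ≤ n_L` / `22000·Kq·(RA′+2) ≤ 30000·Kq·(RA′+2) ≤ M_L` and the box-residual floor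
# `64·(n_b + ℓ_b + |h_b|) ≤ M_L` discharged by `KS.nL_floorsA.1` / `KS.ML_floorsA.1` / `KS.ML_floorsA.2.1` (stmt-g16, ResidualsA).

builds on p205010 (kernel theorem, internal audit signed; external expert review pending) — nothing here uses it; NOTHING is claimed about the open node
`SamePDropOfSkeletonNeg₁`: this is ONE of the four hypotheses of `samePDropOfSkeletonNeg₁_of_choiceFnNOWL NegB.LfA (negChoiceAllOTA …)` (the node₁ file
`SkelNeg1HoldsAllL` meets the (F) and (C) wrappers at the same tuple).
Lane `prim-bschramm`, seat `prim-bschramm-p3` (gen 12; design owner + (R) owner); helper file (`--supports stmt-CriticalPhenomena-4575 --as helper`).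
[cite: KozmaNitzan2024, §4 p. 28 ((32) at the root)]
-/

noncomputable section

open scoped Classical

namespace Summit.CriticalPhenomena.PercolationContinuityZ3.Theorems.Transplant

namespace PlanarSkeletonNeg

/-- **`RootHoldsNOWFnL NegB.LfA` of the (ζ′) choice function** (`gx := KS.gxA c`, `fx := KS.fxA`, `ex := exA`; any `c Px mx`).
[cite: KozmaNitzan2024, §4 p. 28 ((32) at the root)] -/
theorem rootHoldsNOWFnL_negChoiceAllOTA (c : ℕ) (Px : NegB.PSlot) (mx : NegB.GSlot) :
    RootHoldsNOWFnL NegB.LfA (negChoiceAllOTA (NegB.KS.gT 0 (NegB.KS.gxA c)) (NegB.KS.fT 0 NegB.KS.fxA) (NegB.KS.PR 0 Px) (NegB.SUA NegB.exA mx)) :=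
  rootHoldsNOWFnL_negChoiceAllOTA_of_xy _ _ _ _
    (fun κ _ _ _ _ _ Φ t p _ O _ hAt h1 hp0 hp1 hflat du hd =>
      NegB.rootOblTWAt_negBTA_x_exA (NegB.KS.gxA c) NegB.KS.fxA Px mx hAt h1 hp0 hp1 hflat du hd
        -- `2000·Kq·(RA′+2) ≤ 2400·Kq·(RA′+2) ≤ n_L` and `22000·Kq·(RA′+2) ≤ 30000·Kq·(RA′+2) ≤ M_L`
        (le_trans (Nat.mul_le_mul_right _ (Nat.mul_le_mul_right _ (by norm_num)))
          (NegB.KS.nL_floorsA κ Φ t p O.merged (NegB.KS.gT 0 (NegB.KS.gxA c) κ Φ t p O.merged)).1)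
        (le_trans (Nat.mul_le_mul_right _ (Nat.mul_le_mul_right _ (by norm_num))) (NegB.KS.ML_floorsA κ Φ t p O.merged c).1))
    (fun κ _ _ _ _ _ Φ t p _ O _ hAt h1 hp0 hp1 hflat du hd =>
      NegB.rootOblTWAt_negBTA_y_exA (NegB.KS.gxA c) NegB.KS.fxA Px mx hAt h1 hp0 hp1 hflat du hd
        (le_trans (Nat.mul_le_mul_right _ (Nat.mul_le_mul_right _ (by norm_num)))
          (NegB.KS.nL_floorsA κ Φ t p O.merged (NegB.KS.gT 0 (NegB.KS.gxA c) κ Φ t p O.merged)).1)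
        (le_trans (Nat.mul_le_mul_right _ (Nat.mul_le_mul_right _ (by norm_num))) (NegB.KS.ML_floorsA κ Φ t p O.merged c).1)
        -- `64·(n_b + ℓ_b + |h_b|) ≤ M_L` at `gxA c`
        (NegB.KS.ML_floorsA κ Φ t p O.merged c).2.1)

end PlanarSkeletonNeg

end Summit.CriticalPhenomena.PercolationContinuityZ3.Theorems.Transplant

end
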